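import Literature.AnabelianGeometry.AbsoluteAnabelian.GaloisCyclotomeOpenSubgroup
import Literature.AnabelianGeometry.AbsoluteAnabelian.GaloisCyclotomeFunctoriality
import HarnessLib

/-!
# [AbsTopIII] Cor. 1.10 (i): `μ_{ℚ/ℤ}` is functorial in injective OPEN homomorphisms

Mochizuki, *Topics in Absolute Anabelian Geometry III*, §1, Cor. 1.10 (i), manuscript p. 42 (lit key
`paper:url-5493eb38cbb7`): "Here, the asserted 'functoriality' is with respect to arbitrary injective
open homomorphisms of profinite groups".  An injective open (continuous) homomorphism `f : G → G'` of
compact Hausdorff groups is an isomorphism of topological groups onto the open subgroup `f(G)`; so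
the functoriality is the composite of TRANSPORT ALONG ISOMORPHISMS (`muQZ.congr`,
`GaloisCyclotomeFunctoriality.lean`, abc-iut-L4-t1) and OPEN-SUBGROUP INVARIANCE
(`muQZ.restrictOpenEquiv`, `GaloisCyclotomeOpenSubgroup.lean`, abc-iut-L4-t17):
`muQZ.mapOfOpenEmbedding f : μ_{ℚ/ℤ}(G) ≃+ μ_{ℚ/ℤ}(G')`.  (The index factor that appears on `μ_Ẑ`/`H²`
for non-bijective `f`, Rmk. 1.10.1 (i) p. 44, concerns the cohomological isomorphism of Cor. 1.10 (a),
not the module `μ_{ℚ/ℤ}` — not here.)  Topological group theory only; nothing here bears on the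
disputed parts of IUT.
-/

noncomputable section

universe u

namespace Literature.AnabelianGeometry.AbsoluteAnabelian

/-! ### Functoriality in injective OPEN homomorphisms -/

section OpenEmbedding

variable {G : Type u} [Group G] [TopologicalSpace G] [IsTopologicalGroup G] [CompactSpace G]
  {G' : Type u} [Group G'] [TopologicalSpace G'] [IsTopologicalGroup G'] [CompactSpace G']
  [T2Space G']

/-- The range of a continuous homomorphism with open range, as an open subgroup.
[cite: MochizukiAbsTopIII2015, Cor 1.10 (i) p.42] -/
def rangeOpenSubgroup (f : G →ₜ* G') (hf : IsOpen (Set.range f)) : OpenSubgroup G' :=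
  ⟨f.toMonoidHom.range, by change IsOpen (Set.range f); exact hf⟩

/-- An injective continuous homomorphism with open range from a compact group to a Hausdorff group
is a topological group isomorphism onto its range. [cite: MochizukiAbsTopIII2015, Cor 1.10 (i) p.42] -/
def equivRangeOfInjective (f : G →ₜ* G') (hinj : Function.Injective f)
    (hf : IsOpen (Set.range f)) :
    G ≃ₜ* ((rangeOpenSubgroup f hf : OpenSubgroup G') : Subgroup G') :=
  let e : G ≃* f.toMonoidHom.range := MonoidHom.ofInjective hinj
  have hc : Continuous e := Continuous.subtype_mk f.continuous _
  let h : G ≃ₜ f.toMonoidHom.range := hc.homeoOfEquivCompactToT2 (f := e.toEquiv)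
  { e with
    continuous_toFun := hc
    continuous_invFun := h.symm.continuous }

/-- **Functoriality of `μ_{ℚ/ℤ}` in injective open homomorphisms** ([AbsTopIII] Cor. 1.10 (i) p. 42:
"the asserted 'functoriality' is with respect to arbitrary injective open homomorphisms of profinite
groups"): an injective continuous homomorphism `f : G → G'` of compact (Hausdorff) groups with open
image induces `μ_{ℚ/ℤ}(G) ≅ μ_{ℚ/ℤ}(f(G)) ≅ μ_{ℚ/ℤ}(G')` — transport along `G ≅ f(G)` (`muQZ.congr`,
abc-iut-L4-t1) followed by open-subgroup invariance (`muQZ.restrictOpenEquiv`).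
[cite: MochizukiAbsTopIII2015, Cor 1.10 (i) p.42] -/
def muQZ.mapOfOpenEmbedding (f : G →ₜ* G') (hinj : Function.Injective f)
    (hf : IsOpen (Set.range f)) : muQZ G ≃+ muQZ G' :=
  (muQZ.congr (equivRangeOfInjective f hinj hf)).trans (muQZ.restrictOpenEquiv (rangeOpenSubgroup f hf))

end OpenEmbedding

end Literature.AnabelianGeometry.AbsoluteAnabelian
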